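import Literature.Barriers.CriticalPhenomena.LaceExpansionIsingDeconvolutionThm22
import Mathlib.Analysis.Fourier.RiemannLebesgueLemma
import HarnessLib

/-!
# Liu–Slade 2026, Theorem 2.2 on the Brillouin zone: "Proof of Theorem 2.2 assuming
# Proposition 3.2" with cube-side, character-tested derivatives

Barrier catalogue `Literature/Barriers/CriticalPhenomena/` (D-0021), second proofs companion of
the named fact `LiuSlade2026_thm22` (`LaceExpansionIsingDeconvolutionParts.lean`), continuing
`LaceExpansionIsingDeconvolutionThm22.lean` (which reduces Theorem 2.2 to Proposition 3.2 stated
with torus-side weak derivatives, `LiuSlade2026_thm22_of_prop32`). The printed proof of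
Proposition 3.2 (Liu–Slade 2026, §3.1–3.2) computes the derivatives of `f̂_z = 1/F̂_z - λ_z/Â_{μ_z}`
by the product and quotient rules and bounds them in `L^q([-π,π]^d)`; the tree's machinery for
exactly this computation (slice derivatives `soSymbolD` of `D̂`, the Dirichlet majorant, the
one-axis integration by parts `LiuSlade2026_lem31_fiber_holds`) lives on the CUBE side
(`latticeFT`, Lebesgue measure on `cube d = [-π,π]^d`). This file therefore restates the reduction
on the cube side and in the weakest form the printed argument uses:

* `lsfHatC d L z Π k = 1/F̂_z(k) - λ_z/Â_{μ_z}(k)` — `f̂_z` of (3.5) as a function of `k ∈ ℝ^d`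
  (`latticeFT`, i.e. `latticeFourier` in the coordinate `k = -2πt`);
* `re_latticeFT_sub_re_latticeFT_zero_ge` — the infrared bound (2.3) on the cube, from the
  torus-side `LiuSlade2026_infraredBound_holds`;
* `sub_eq_re_integral_lsfHatC` — (3.4) on the cube:
  `𝒢_z(x) - λ_z S_{μ_z}(x) = Re (2π)^{-d} ∫_{[-π,π]^d} e^{ik·x} f̂_z(k) dk`;
* `tendsto_setIntegral_cube_cexp_mul_cofinite` — the Riemann–Lebesgue lemma on the cube along
  `ℤ^d` (Mathlib's `tendsto_integral_exp_smul_cocompact`);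
* `LiuSlade2026_thm22_of_prop32_cube` — **Theorem 2.2 from Proposition 3.2 in cube-side,
  character-tested form**: it suffices that, for `β` small and `L ≥ L₀`, `f̂_z ∈ L¹([-π,π]^d)`
  with `∫|f̂_z| ≤ Cβ` and that for every axis `j` there is `w_j ∈ L¹([-π,π]^d)` with
  `∫|w_j| ≤ C(β(L^{-c} + β) + β₁)` and `∫ e^{ik·x} w_j(k) dk = (-i x_j)^{n_d} ∫ e^{ik·x} f̂_z(k) dk`
  for all `x ∈ ℤ^d` — the identity that `n_d` integrations by parts in `k_j` produce for the weak
  (or fibrewise classical) derivative `w_j = ∂_j^{n_d} f̂_z` (Lemma 3.1's proof tests the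
  derivative only against characters), and which is stable under the limits by which such `w_j`
  are constructed.

No new named facts (D-0026); Proposition 3.2 in this form remains the obligation of
`LiuSlade2026_thm22_holds`.

## References

* Y. Liu, G. Slade, *Gaussian deconvolution and the lace expansion for spread-out models*,
  Ann. Inst. H. Poincaré Probab. Statist. 62 (2026), arXiv:2310.07640: (1.4), (2.1), (2.3),
  Theorem 2.2 with (2.8); §3.1: (3.4)–(3.5), Lemma 3.1 with (3.7), Proposition 3.2 with
  (3.8)–(3.9), "Proof of Theorem 2.2 assuming Proposition 3.2" [LiuSlade2026]. Equation numbers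
  are those of the arXiv version held in the literature store.
* Y. Liu, G. Slade, *Gaussian deconvolution and the lace expansion*, Probab. Theory Related
  Fields 195 (2024), arXiv:2310.07635: Lemma 2.3 and its proof (integration by parts against the
  characters; Riemann–Lebesgue) [LiuSlade2024].
-/

noncomputable section

namespace Literature.Barriers.CriticalPhenomena.SpreadOutIsing

open Filter UnitAddTorus Literature.Probability.LatticeModels
open _root_.MeasureTheory _root_.Topology
open scoped FourierTransform

variable {d L : ℕ}

/-! ## Part 1. `f̂_z` on the cube and the cube-side infrared bound -/

/-- `f̂_z(k) = 1/F̂_z(k) - λ_z/Â_{μ_z}(k)` ((3.5)) as a function of `k ∈ ℝ^d`, with the cube-side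
transform `latticeFT` (`F̂(k) = Σ_x F(x)e^{-ik·x}`); `lsfHat d L z Π t = lsfHatC d L z Π (-2πy)` at
`t = y mod 1` (`latticeFourier_coe_eq_latticeFT`). [cite: LiuSlade2026, (3.5)] -/
def lsfHatC (d L : ℕ) (z : ℝ) (Pz : Site d → ℝ) (k : Fin d → ℝ) : ℂ :=
  (latticeFT (lsF d L z Pz) k)⁻¹ -
    (lsLambda d L (lsF d L z Pz) : ℂ) * (latticeFT (soA d L (lsMu d L (lsF d L z Pz))) k)⁻¹

/-- A point of the cube `[-π,π]^d` is `-2πy` with `y ∈ [-1/2,1/2]^d`, on which the quotient norms of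
the torus are `‖(y_i mod 1)‖ = |y_i| = |k_i|/(2π)`. [folklore] -/
theorem exists_rep_of_mem_cube {k : Fin d → ℝ} (hk : k ∈ cube d) :
    ∃ y : Fin d → ℝ, (∀ i, |y i| ≤ 1 / 2) ∧ (-(2 * Real.pi)) • y = k ∧
      ∀ i, ‖((y i : ℝ) : UnitAddCircle)‖ ^ 2 = k i ^ 2 / (4 * Real.pi ^ 2) := by
  have hπ : 0 < Real.pi := Real.pi_pos
  refine ⟨fun i => -(k i / (2 * Real.pi)), fun i => ?_, ?_, fun i => ?_⟩
  · have h := hk i (Set.mem_univ i)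
    rw [abs_neg, abs_div, abs_of_pos (by positivity : (0 : ℝ) < 2 * Real.pi), div_le_iff₀ (by positivity),
      abs_le]
    constructor <;> nlinarith [h.1, h.2]
  · funext i
    simp only [Pi.smul_apply, smul_eq_mul]
    field_simp
  · have habs : |(-(k i / (2 * Real.pi)))| ≤ 1 / 2 := by
      have h := hk i (Set.mem_univ i)
      rw [abs_neg, abs_div, abs_of_pos (by positivity : (0 : ℝ) < 2 * Real.pi),
        div_le_iff₀ (by positivity), abs_le]
      constructor <;> nlinarith [h.1, h.2]
    rw [(AddCircle.norm_coe_eq_abs_iff (p := (1 : ℝ)) one_ne_zero).2 (by simpa using habs), sq_abs]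
    field_simp
    ring

/-- **The infrared bound (2.3) on the cube**: under the hypotheses of `LiuSlade2026_infraredBound`
at level `L` (as delivered by `LiuSlade2026_infraredBound_holds`), for `k ∈ [-π,π]^d`,
`Re F̂_z(k) - Re F̂_z(0) ≥ K_IR (L²|k|²/(4π²) ∧ 1)` (`|k|² = Σ_i k_i²`; the torus statement read at
the representative `y = -k/(2π)`). [cite: LiuSlade2026, (2.3) and (3.18)] -/
theorem re_latticeFT_sub_re_latticeFT_zero_ge {K : ℝ} {z : ℝ} {Pz : Site d → ℝ}
    (hIR : ∀ t : UnitAddTorus (Fin d),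
      K * min ((L : ℝ) ^ 2 * ∑ i, ‖t i‖ ^ 2) 1 ≤
        (latticeFourier (lsF d L z Pz) t).re - (latticeFourier (lsF d L z Pz) 0).re)
    {k : Fin d → ℝ} (hk : k ∈ cube d) :
    K * min ((L : ℝ) ^ 2 * (∑ i, k i ^ 2) / (4 * Real.pi ^ 2)) 1 ≤
      (latticeFT (lsF d L z Pz) k).re - (latticeFT (lsF d L z Pz) 0).re := by
  obtain ⟨y, -, hyk, hnorm⟩ := exists_rep_of_mem_cube hk
  have h := hIR (fun i => ((y i : ℝ) : UnitAddCircle))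
  rw [latticeFourier_coe_eq_latticeFT, hyk, latticeFourier_zero_eq_latticeFT] at h
  have hsum : ∑ i, ‖((y i : ℝ) : UnitAddCircle)‖ ^ 2 = (∑ i, k i ^ 2) / (4 * Real.pi ^ 2) := by
    rw [Finset.sum_div]
    exact Finset.sum_congr rfl fun i _ => hnorm i
  rwa [hsum, ← mul_div_assoc] at h

/-- On the cube, `L²|k|²/(4π²) ∧ 1 ≥ |k|²/(4π² max(dπ²,1))`-type comparison: for `L ≥ 1` and
`Σ k_i² ≤ dπ²`, `min (L² Σk_i²/(4π²)) 1 ≥ Σ k_i² / (4π² + dπ²)`. [folklore] -/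
theorem sum_sq_div_le_min (hL : (1 : ℝ) ≤ L) {k : Fin d → ℝ} (hk : k ∈ cube d) :
    (∑ i, k i ^ 2) / (4 * Real.pi ^ 2 + d * Real.pi ^ 2) ≤
      min ((L : ℝ) ^ 2 * (∑ i, k i ^ 2) / (4 * Real.pi ^ 2)) 1 := by
  have hπ : 0 < Real.pi := Real.pi_pos
  have hs0 : 0 ≤ ∑ i, k i ^ 2 := Finset.sum_nonneg fun i _ => sq_nonneg _
  have hsd : ∑ i, k i ^ 2 ≤ d * Real.pi ^ 2 := by
    calc ∑ i, k i ^ 2 ≤ ∑ _i : Fin d, Real.pi ^ 2 := Finset.sum_le_sum fun i _ => by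
            have h := hk i (Set.mem_univ i)
            rw [← sq_abs]
            exact pow_le_pow_left₀ (abs_nonneg _) (abs_le.2 ⟨h.1, h.2⟩) 2
      _ = d * Real.pi ^ 2 := by simp
  have hden : 0 < 4 * Real.pi ^ 2 + d * Real.pi ^ 2 := by positivity
  refine le_min ?_ ?_
  · rw [div_le_div_iff₀ hden (by positivity)]
    have hL2 : (1 : ℝ) ≤ (L : ℝ) ^ 2 := one_le_pow₀ hL
    have hd0 : (0 : ℝ) ≤ d * Real.pi ^ 2 := by positivity
    nlinarith [mul_le_mul_of_nonneg_right hL2 (mul_nonneg hs0 (le_of_lt (by positivity : (0:ℝ) < 4 * Real.pi ^ 2)))]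
  · rw [div_le_one hden]
    linarith [hsd, (by positivity : (0 : ℝ) ≤ 4 * Real.pi ^ 2)]

/-- **`1/F̂` is integrable on the cube** for `d ≥ 3` when `F` is absolutely summable and even and
`Re F̂(k) ≥ K Σ_i k_i²` on the cube (`K > 0`) — the tree's `integrableOn_inv_one_sub_latticeFT` for
the kernel `J = δ - F` (`1 - Ĵ = F̂`). [cite: LiuSlade2026, §2.1 (absolute convergence of (2.1) for d > 2)] -/
theorem integrableOn_inv_latticeFT (hd : 3 ≤ d) {F : Site d → ℝ} (hF : Summable fun x => |F x|)
    (hFe : ∀ x, F (-x) = F x) {K : ℝ} (hK : 0 < K)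
    (hlow : ∀ k ∈ cube d, K * ∑ i, k i ^ 2 ≤ (latticeFT F k).re) :
    IntegrableOn (fun k => (latticeFT F k)⁻¹) (cube d) := by
  have hd0 : (0 : ℝ) < d := by exact_mod_cast (show 0 < d by omega)
  have hJ : Summable fun x : Site d => |delta0 x - F x| := (summable_abs_delta0.of_abs.sub hF.of_abs).abs
  have hJe : ∀ x : Site d, delta0 (-x) - F (-x) = delta0 x - F x := fun x => by
    rw [hFe]
    unfold delta0
    simp only [neg_eq_zero]
  have hre : ∀ k, 1 - (latticeFT (fun x => delta0 x - F x) k).re = (latticeFT F k).re := fun k => by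
    have := congrArg Complex.re (one_sub_latticeFT_delta0_sub hF k)
    simpa using this
  have h := integrableOn_inv_one_sub_latticeFT hd hJ hJe (K₀ := 2 * d * K) (by positivity)
    (fun k hk => by
      rw [hre]
      calc 2 * d * K * (∑ i, k i ^ 2) / (2 * d) = K * ∑ i, k i ^ 2 := by field_simp
        _ ≤ (latticeFT F k).re := hlow k hk)
  refine h.congr_fun (fun k _ => ?_) (measurableSet_cube d)
  simp only
  rw [one_sub_latticeFT_delta0_sub hF]

/-- `Â_μ = 1 - μD̂` on the cube. [cite: LiuSlade2026, Lemma 3.6 ("Â_μ = 1 - μD̂")] -/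
theorem latticeFT_soA (μ : ℝ) (k : Fin d → ℝ) :
    latticeFT (soA d L μ) k = 1 - (μ : ℂ) * latticeFT (soStep d L) k := by
  have hD : Summable fun y : Site d => |μ * soStep d L y| := (summable_abs_soStep.of_abs.mul_left μ).abs
  have h1 : latticeFT (soA d L μ) k = latticeFT delta0 k - latticeFT (fun y => μ * soStep d L y) k := by
    rw [← latticeFT_sub summable_abs_delta0 hD]
    rfl
  have hlin : latticeFT (fun y => μ * soStep d L y) k = (μ : ℂ) * latticeFT (soStep d L) k := by
    unfold latticeFT; rw [← tsum_mul_left]; exact tsum_congr fun y => by push_cast; ring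
  rw [h1, latticeFT_delta0, hlin]

/-! ## Part 2. (3.4) on the cube: `𝒢_z(x) - λ_z S_{μ_z}(x) = Re (2π)^{-d}∫ e^{ik·x} f̂_z(k) dk` -/

/-- The Fourier integral (2.1) on the cube: for absolutely summable `F` with `1/F̂` integrable on
`[-π,π]^d`, `𝒢(x) = Re[(∫_{[-π,π]^d} e^{ik·x}/F̂(k) dk)/(2π)^d]` (Hara's `H(x)`,
`fourierInverseG_eq_re_haraH`, with `ĝ = δ̂₀ = 1` and `1 - Ĵ = F̂`). [cite: LiuSlade2026, (2.1)] -/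
theorem fourierInverseG_eq_re_integral_cube {F : Site d → ℝ} (hF : Summable fun x => |F x|) (x : Site d) :
    fourierInverseG F x =
      ((∫ k in cube d, Complex.exp (Complex.I * (kdot k x : ℂ)) * (latticeFT F k)⁻¹) /
        ((2 * Real.pi : ℂ)) ^ d).re := by
  rw [fourierInverseG_eq_re_haraH hF x, haraH]
  have h : (∫ k in cube d, haraIntegrand (fun y => delta0 y - F y) delta0 x k) =
      ∫ k in cube d, Complex.exp (Complex.I * (kdot k x : ℂ)) * (latticeFT F k)⁻¹ := by
    refine setIntegral_congr_fun (measurableSet_cube d) fun k _ => ?_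
    unfold haraIntegrand
    rw [latticeFT_delta0, one_sub_latticeFT_delta0_sub hF, one_div]
  rw [h]

/-- **(3.4)–(3.5) on the cube**: for `d ≥ 3`, `L ≥ 1`, `μ_z ∈ [0,1]` and `1/F̂_z`, `1/Â_{μ_z}`
integrable on `[-π,π]^d`,
`𝒢_z(x) - λ_z S_{μ_z}(x) = Re[(∫_{[-π,π]^d} e^{ik·x} f̂_z(k) dk)/(2π)^d]` (`f̂_z = lsfHatC`).
[cite: LiuSlade2026, (3.4)–(3.5)] -/
theorem sub_eq_re_integral_lsfHatC (hd : 3 ≤ d) (hL : 1 ≤ L) {z : ℝ} {Pz : Site d → ℝ}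
    (hFabs : Summable fun x => |lsF d L z Pz x|)
    (hμ0 : 0 ≤ lsMu d L (lsF d L z Pz)) (hμ1 : lsMu d L (lsF d L z Pz) ≤ 1)
    (hintF : IntegrableOn (fun k => (latticeFT (lsF d L z Pz) k)⁻¹) (cube d))
    (hintA : IntegrableOn (fun k => (latticeFT (soA d L (lsMu d L (lsF d L z Pz))) k)⁻¹) (cube d))
    (x : Site d) :
    fourierInverseG (lsF d L z Pz) x -
        lsLambda d L (lsF d L z Pz) * soGreen d L (lsMu d L (lsF d L z Pz)) x =
      ((∫ k in cube d, Complex.exp (Complex.I * (kdot k x : ℂ)) * lsfHatC d L z Pz k) /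
        ((2 * Real.pi : ℂ)) ^ d).re := by
  set F := lsF d L z Pz with hFdef
  set lam := lsLambda d L F
  set μ := lsMu d L F
  have he : ∀ k : Fin d → ℝ, ‖Complex.exp (Complex.I * (kdot k x : ℂ))‖ ≤ 1 := fun k => by
    rw [mul_comm, Complex.norm_exp_ofReal_mul_I]
  have hec : Continuous fun k : Fin d → ℝ => Complex.exp (Complex.I * (kdot k x : ℂ)) :=
    Complex.continuous_exp.comp (continuous_const.mul (Complex.continuous_ofReal.comp (continuous_kdot_left x)))
  have hi1 : IntegrableOn (fun k => Complex.exp (Complex.I * (kdot k x : ℂ)) * (latticeFT F k)⁻¹) (cube d) :=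
    hintF.bdd_mul (c := 1) hec.aestronglyMeasurable (ae_of_all _ he)
  have hi2 : IntegrableOn (fun k => Complex.exp (Complex.I * (kdot k x : ℂ)) *
      ((lam : ℂ) * (latticeFT (soA d L μ) k)⁻¹)) (cube d) :=
    (hintA.const_mul (lam : ℂ)).bdd_mul (c := 1) hec.aestronglyMeasurable (ae_of_all _ he)
  have hsplit : (∫ k in cube d, Complex.exp (Complex.I * (kdot k x : ℂ)) * lsfHatC d L z Pz k) =
      (∫ k in cube d, Complex.exp (Complex.I * (kdot k x : ℂ)) * (latticeFT F k)⁻¹) -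
        (lam : ℂ) * ∫ k in cube d, Complex.exp (Complex.I * (kdot k x : ℂ)) * (latticeFT (soA d L μ) k)⁻¹ := by
    rw [← integral_const_mul, ← integral_sub hi1 (hi2.congr_fun (fun k _ => by ring) (measurableSet_cube d))]
    refine setIntegral_congr_fun (measurableSet_cube d) fun k _ => ?_
    simp only [lsfHatC]
    ring
  rw [hsplit, sub_div, Complex.sub_re, mul_div_assoc, Complex.re_ofReal_mul,
    ← fourierInverseG_eq_re_integral_cube hFabs x,
    ← fourierInverseG_eq_re_integral_cube (summable_abs_soA μ) x, fourierInverseG_soA hd hL hμ0 hμ1 x]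

/-! ## Part 3. The Riemann–Lebesgue lemma on the cube along `ℤ^d` -/

/-- The linear functional `k ↦ -k·x/(2π)` on `ℝ^d`, for `x ∈ ℤ^d`, through which the character
`e^{ik·x} = 𝐞(-(-k·x/2π))` is an instance of Mathlib's Fourier kernel. [folklore] -/
def charDual (x : Site d) : StrongDual ℝ (Fin d → ℝ) :=
  (-(1 / (2 * Real.pi))) • ∑ j : Fin d, ((x j : ℤ) : ℝ) • ContinuousLinearMap.proj (R := ℝ) j

/-- `charDual x k = -k·x/(2π)`. [folklore] -/
theorem charDual_apply (x : Site d) (k : Fin d → ℝ) : charDual x k = -(kdot k x / (2 * Real.pi)) := by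
  simp only [charDual, FunLike.coe_smul, FunLike.coe_sum, Pi.smul_apply,
    Finset.sum_apply, ContinuousLinearMap.proj_apply, smul_eq_mul, kdot]
  rw [neg_mul, one_div, ← div_eq_inv_mul, neg_inj]
  congr 1
  exact Finset.sum_congr rfl fun j _ => mul_comm _ _

/-- `𝐞(-charDual x k) = e^{ik·x}`. [folklore] -/
theorem fourierChar_neg_charDual (x : Site d) (k : Fin d → ℝ) :
    ((𝐞 (-(charDual x k)) : ℂ)) = Complex.exp (Complex.I * (kdot k x : ℂ)) := by
  rw [Real.fourierChar_apply, charDual_apply, neg_neg]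
  congr 1
  have hπ : (Real.pi : ℂ) ≠ 0 := Complex.ofReal_ne_zero.2 Real.pi_ne_zero
  push_cast
  field_simp

/-- `‖x‖_∞ ≤ 2π ‖charDual x‖` (test against the coordinate vectors), so `charDual x → ∞` along the
cofinite filter of `ℤ^d`. [folklore] -/
theorem norm_le_mul_norm_charDual (x : Site d) : ‖x‖ ≤ 2 * Real.pi * ‖charDual x‖ := by
  have hπ : 0 < Real.pi := Real.pi_pos
  refine (pi_norm_le_iff_of_nonneg (by positivity)).2 fun j => ?_
  have h := (charDual x).le_opNorm (Pi.single j (1 : ℝ))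
  have hs : ‖(Pi.single j (1 : ℝ) : Fin d → ℝ)‖ = 1 := by
    rw [Pi.norm_single, norm_one]
  rw [hs, mul_one, charDual_apply, norm_neg, Real.norm_eq_abs, abs_div,
    abs_of_pos (by positivity : (0 : ℝ) < 2 * Real.pi)] at h
  have hk : kdot (Pi.single j (1 : ℝ)) x = (x j : ℝ) := by
    unfold kdot
    rw [Finset.sum_eq_single j (fun i _ hij => by rw [Pi.single_eq_of_ne hij, zero_mul])
      (fun hj => (hj (Finset.mem_univ j)).elim), Pi.single_eq_same, one_mul]
  rw [hk] at h
  rw [Int.norm_eq_abs, ← Int.cast_abs]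
  have : |((x j : ℤ) : ℝ)| ≤ 2 * Real.pi * ‖charDual x‖ := by
    rw [div_le_iff₀ (by positivity)] at h; linarith
  exact_mod_cast this

/-- `charDual` tends to infinity (leaves every compact set) along the cofinite filter of `ℤ^d`.
[folklore] -/
theorem tendsto_charDual_cocompact :
    Tendsto (charDual : Site d → StrongDual ℝ (Fin d → ℝ)) cofinite (cocompact _) := by
  rw [← Metric.cobounded_eq_cocompact, ← tendsto_norm_atTop_iff_cobounded]
  have h1 : Tendsto (fun x : Site d => ‖x‖) cofinite atTop := by
    rw [← cocompact_eq_cofinite (Site d)]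
    exact tendsto_norm_cocompact_atTop
  have h2 : Tendsto (fun x : Site d => ‖x‖ / (2 * Real.pi)) cofinite atTop :=
    h1.atTop_div_const (by positivity)
  refine tendsto_atTop_mono (fun x => ?_) h2
  rw [div_le_iff₀ (by positivity)]
  linarith [norm_le_mul_norm_charDual x]

/-- **The Riemann–Lebesgue lemma on the Brillouin zone**: for any `w : ℝ^d → ℂ`,
`∫_{[-π,π]^d} e^{ik·x} w(k) dk → 0` as `x → ∞` in `ℤ^d` (Mathlib's
`tendsto_integral_exp_smul_cocompact` for the finite-dimensional space `ℝ^d`, composed with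
`charDual`; no integrability hypothesis is needed, the integral being `0` otherwise).
[cite: LiuSlade2024, Lemma 2.3 (proof: Riemann–Lebesgue)] -/
theorem tendsto_setIntegral_cube_cexp_mul_cofinite (w : (Fin d → ℝ) → ℂ) :
    Tendsto (fun x : Site d => ∫ k in cube d, Complex.exp (Complex.I * (kdot k x : ℂ)) * w k)
      cofinite (𝓝 0) := by
  have h := (tendsto_integral_exp_smul_cocompact ((cube d).indicator w) (volume : Measure (Fin d → ℝ))).comp
    tendsto_charDual_cocompact
  refine (tendsto_congr fun x => ?_).1 h
  simp only [Function.comp_apply]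
  rw [← integral_indicator (measurableSet_cube d)]
  refine integral_congr_ae (ae_of_all _ fun k => ?_)
  simp only [Circle.smul_def, smul_eq_mul]
  by_cases hk : k ∈ cube d
  · rw [Set.indicator_of_mem hk, Set.indicator_of_mem hk, fourierChar_neg_charDual]
  · rw [Set.indicator_of_notMem hk, Set.indicator_of_notMem hk, mul_zero]

/-! ## Part 4. Theorem 2.2 from Proposition 3.2 in cube-side, character-tested form -/

/-- **Liu–Slade 2026, "Proof of Theorem 2.2 assuming Proposition 3.2" — cube side.** The
hypothesis `h32` is the part of Proposition 3.2 consumed by the printed proof, on the Brillouin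
zone `[-π,π]^d` and with the top-order derivatives tested against characters only: under
Assumption 2.1 with `β = β₀ ∨ β₁ ≤ β⋆` and `L ≥ L₀`, `f̂_z` (`lsfHatC`) is integrable on the cube
with `∫|f̂_z| ≤ Cβ` ((3.8), `α = 0`, `r = 1`), and for every axis `j` there is an integrable `w_j`
with `∫|w_j| ≤ C(β(L^{-c} + β) + β₁)` ((3.9), `|α| = n_d`, `r = 1`) and
`∫ e^{ik·x} w_j(k) dk = (-i x_j)^{n_d} ∫ e^{ik·x} f̂_z(k) dk` for all `x ∈ ℤ^d` — the identity
satisfied by the derivative `w_j = ∂_j^{n_d} f̂_z` (weak, Liu–Slade 2024, Def. A.1, or classical on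
almost every fibre) after `n_d` integrations by parts in `k_j`, which is all that the proof of
Lemma 3.1 uses. Conclusion: the named fact `LiuSlade2026_thm22`. Proof as printed (§3.1):
`𝒢_z - λ_z S_{μ_z} = f_z = Re (2π)^{-d}∫e^{ik·x}f̂_z` (`sub_eq_re_integral_lsfHatC`, both Fourier
integrals converging absolutely by the infrared bounds (2.3)/(3.15) on the cube,
`re_latticeFT_sub_re_latticeFT_zero_ge`, `integrableOn_inv_latticeFT`, with `μ_z ∈ [0,1]`,
`λ_z ∈ (0,2]` from (2.5)–(2.6)); `|f_z(x)| ≤ (2π)^{-d}∫|f̂_z| ≲ β`; for `x ≠ 0`, with `j`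
maximising `|x_j| ≥ |x|/√d`, `|x_j|^{n_d}|∫e^{ik·x}f̂_z| = |∫e^{ik·x}w_j| ≤ ∫|w_j|` (Lemma 3.1);
and `|x|^{n_d} f_z(x) → 0` by the Riemann–Lebesgue lemma for the `w_j`
(`tendsto_setIntegral_cube_cexp_mul_cofinite`).
[cite: LiuSlade2026, Theorem 2.2, "Proof of Theorem 2.2 assuming Proposition 3.2" (§3.1), Proposition 3.2 with (3.8)–(3.9), Lemma 3.1 with (3.7)] -/
theorem LiuSlade2026_thm22_of_prop32_cube
    (h32 : ∀ d : ℕ, 2 < d → ∀ ρ : ℝ, max (((d : ℝ) - 8) / 2) 0 < ρ →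
      ∃ βs : ℝ, 0 < βs ∧ ∃ c : ℝ, 0 < c ∧ ∃ C : ℝ, ∃ L₀ : ℕ, ∀ L : ℕ, L₀ ≤ L →
        ∀ (z β₀ β₁ : ℝ) (Pz : Site d → ℝ), 0 ≤ β₀ → 0 ≤ β₁ → max β₀ β₁ ≤ βs →
          LSAssumptionF d L ρ β₀ β₁ z Pz →
            IntegrableOn (lsfHatC d L z Pz) (cube d) ∧
            (∫ k in cube d, ‖lsfHatC d L z Pz k‖) ≤ C * max β₀ β₁ ∧
            ∀ j : Fin d, ∃ w : (Fin d → ℝ) → ℂ, IntegrableOn w (cube d) ∧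
              (∫ k in cube d, ‖w k‖) ≤ C * (max β₀ β₁ * ((L : ℝ) ^ (-c) + max β₀ β₁) + β₁) ∧
              ∀ x : Site d,
                (∫ k in cube d, Complex.exp (Complex.I * (kdot k x : ℂ)) * w k) =
                  (-(Complex.I * (x j : ℂ))) ^ lsND d ρ *
                    ∫ k in cube d, Complex.exp (Complex.I * (kdot k x : ℂ)) * lsfHatC d L z Pz k) :
    LiuSlade2026_thm22 := by
  intro d hd ρ hρ
  have hd1 : 1 ≤ d := by omega
  have hd3 : 3 ≤ d := by omega
  have hπ : 0 < Real.pi := Real.pi_pos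
  have hρ0 : 0 < ρ := lt_of_le_of_lt (le_max_right _ _) hρ
  have hsd : (d : ℝ) < (d : ℝ) + 2 + ρ := by linarith
  -- the inputs: (2.3), (2.5)–(2.6), Proposition 3.2
  obtain ⟨βs₁, hβs₁, K, hK, L₁, hIR⟩ := LiuSlade2026_infraredBound_holds d hd1 ρ hρ
  obtain ⟨Kl, hKl, hlam⟩ := exists_lsLambda_estimates d hd1 hρ0
  obtain ⟨βs₂, hβs₂, c, hc, C₂, L₂, h32'⟩ := h32 d hd ρ hρ
  -- the normalising constant `(2π)^{-d}` and `d^{n/2}`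
  set A : ℝ := ((2 * Real.pi) ^ d)⁻¹ with hAdef
  have hA0 : 0 < A := by positivity
  refine ⟨min βs₁ (min βs₂ (1 / (2 * Kl))), lt_min hβs₁ (lt_min hβs₂ (by positivity)), c, hc,
    max (A * C₂) (A * Real.sqrt d ^ lsND d ρ * C₂), max L₁ (max L₂ 1), ?_⟩
  intro L hL z β₀ β₁ Pz hβ₀ hβ₁ hβ hAss
  have hL₁ : L₁ ≤ L := le_trans (le_max_left _ _) hL
  have hL₂ : L₂ ≤ L := le_trans ((le_max_left _ _).trans (le_max_right _ _)) hL
  have hL1 : 1 ≤ L := le_trans ((le_max_right _ _).trans (le_max_right _ _)) hL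
  have hL1r : (1 : ℝ) ≤ L := by exact_mod_cast hL1
  have hβ1 : max β₀ β₁ ≤ βs₁ := hβ.trans (min_le_left _ _)
  have hβ2 : max β₀ β₁ ≤ βs₂ := hβ.trans ((min_le_right _ _).trans (min_le_left _ _))
  have hβnn : 0 ≤ max β₀ β₁ := hβ₀.trans (le_max_left _ _)
  have hKβ : Kl * max β₀ β₁ ≤ 1 / 2 := by
    have h3 : max β₀ β₁ ≤ 1 / (2 * Kl) := hβ.trans ((min_le_right _ _).trans (min_le_right _ _))
    calc Kl * max β₀ β₁ ≤ Kl * (1 / (2 * Kl)) := mul_le_mul_of_nonneg_left h3 hKl.le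
      _ = 1 / 2 := by field_simp
  obtain ⟨hz1, hsymm, hbd, hF0⟩ := hAss
  obtain ⟨-, -, -, -, ⟨hlampos, hlamle2, -⟩, ⟨hμ0, hμ1, -⟩⟩ :=
    hlam L hL1 β₀ β₁ z Pz hβ₀ hβ₁ hKβ ⟨hz1, hsymm, hbd, hF0⟩
  -- abbreviations
  set F : Site d → ℝ := lsF d L z Pz with hFdef
  set lam : ℝ := lsLambda d L F with hlamdef
  set μ : ℝ := lsMu d L F with hμdef
  -- summability and evenness of `F_z`
  have hPabs : Summable fun x => |Pz x| := summable_abs_of_lsBound hβ₀ hbd hsd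
  have hFabs : Summable fun x => |F x| := by
    have hD : Summable fun x : Site d => |z * soStep d L x| := by
      simpa only [abs_mul] using summable_abs_soStep.mul_left |z|
    refine ((summable_abs_delta0.add hD).add hPabs).of_nonneg_of_le (fun x => abs_nonneg _) fun x => ?_
    simp only [hFdef, lsF]
    calc |delta0 x - z * soStep d L x - Pz x| ≤ |delta0 x - z * soStep d L x| + |Pz x| := abs_sub _ _
      _ ≤ |delta0 x| + |z * soStep d L x| + |Pz x| := by gcongr; exact abs_sub _ _
  have hFe : ∀ x, F (-x) = F x := fun x => by
    simp only [hFdef, lsF, soStep_neg, hsymm.neg x]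
    unfold delta0
    simp only [neg_eq_zero]
  -- (2.3) on the cube: `Re F̂_z(k) ≥ K' Σ k_i²`, hence `1/F̂_z ∈ L¹([-π,π]^d)`
  set K' : ℝ := K / (4 * Real.pi ^ 2 + d * Real.pi ^ 2) with hK'def
  have hK' : 0 < K' := by positivity
  have hF0re : (latticeFT F 0).re = ∑' x, F x := by
    rw [← latticeFourier_zero_eq_latticeFT, latticeFourier_zero, Complex.ofReal_re]
  have hlowF : ∀ k ∈ cube d, K' * ∑ i, k i ^ 2 ≤ (latticeFT F k).re := by
    intro k hk
    have h := re_latticeFT_sub_re_latticeFT_zero_ge (hIR L hL₁ z β₀ β₁ Pz hβ₀ hβ₁ hβ1 hz1 hsymm hbd) hk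
    have h0 : 0 ≤ (latticeFT F 0).re := by rw [hF0re]; exact hF0
    have hm := mul_le_mul_of_nonneg_left (sum_sq_div_le_min hL1r hk) hK.le
    rw [← mul_div_assoc] at hm
    calc K' * ∑ i, k i ^ 2 = K * (∑ i, k i ^ 2) / (4 * Real.pi ^ 2 + d * Real.pi ^ 2) := by
          rw [hK'def]; ring
      _ ≤ (latticeFT F k).re := by linarith
  have hintF : IntegrableOn (fun k => (latticeFT F k)⁻¹) (cube d) :=
    integrableOn_inv_latticeFT hd3 hFabs hFe hK' hlowF
  -- (3.15) on the cube for `Â_1`, hence for `Â_μ`, `μ = μ_z ∈ [0,1]`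
  have hlowA1 : ∀ k ∈ cube d, K' * ∑ i, k i ^ 2 ≤ 1 - (latticeFT (soStep d L) k).re := by
    intro k hk
    have hsymm0 : IsZdSymmetric (fun _ : Site d => (0 : ℝ)) := fun _ _ _ => rfl
    have hbd0 : ∀ x : Site d, |(fun _ : Site d => (0 : ℝ)) x| ≤
        0 * delta0 x + 0 / jnorm x ^ ((d : ℝ) + 2 + ρ) := fun x => by simp
    have hIR0 := hIR L hL₁ 1 0 0 (fun _ => 0) le_rfl le_rfl (by rw [max_self]; exact hβs₁.le) le_rfl
      hsymm0 hbd0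
    have h := re_latticeFT_sub_re_latticeFT_zero_ge hIR0 hk
    rw [← soA_eq_lsF] at h
    -- `Â_1 = 1 - D̂` on the cube, `Â_1(0) = 0`
    have hA1 : ∀ k', latticeFT (soA d L 1) k' = 1 - latticeFT (soStep d L) k' := fun k' => by
      rw [latticeFT_soA]; push_cast; ring
    have hA10 : (latticeFT (soA d L 1) 0).re = 0 := by
      rw [hA1, Complex.sub_re, Complex.one_re, soSymbol_eq_re_latticeFT, soSymbol_zero hd1 hL1, sub_self]
    rw [hA10, sub_zero, hA1, Complex.sub_re, Complex.one_re] at h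
    have hm := mul_le_mul_of_nonneg_left (sum_sq_div_le_min hL1r hk) hK.le
    rw [← mul_div_assoc] at hm
    calc K' * ∑ i, k i ^ 2 = K * (∑ i, k i ^ 2) / (4 * Real.pi ^ 2 + d * Real.pi ^ 2) := by
          rw [hK'def]; ring
      _ ≤ 1 - (latticeFT (soStep d L) k).re := by linarith
  have hlowA : ∀ k ∈ cube d, K' / 2 * ∑ i, k i ^ 2 ≤ (latticeFT (soA d L μ) k).re := by
    intro k hk
    have h1 := hlowA1 k hk
    -- `Re Â_μ ≥ (1 - Re D̂)/2` for `μ ∈ [0,1]`, `|Re D̂| ≤ 1`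
    have hAμ : latticeFT (soA d L μ) k = 1 - (μ : ℂ) * latticeFT (soStep d L) k := latticeFT_soA μ k
    have hD : |(latticeFT (soStep d L) k).re| ≤ 1 := by
      rw [soSymbol_eq_re_latticeFT]; exact abs_soSymbol_le_one k
    rw [hAμ, Complex.sub_re, Complex.one_re, Complex.re_ofReal_mul]
    have hD1 := (abs_le.1 hD).1
    have hs0 : 0 ≤ ∑ i, k i ^ 2 := Finset.sum_nonneg fun i _ => sq_nonneg _
    rcases le_or_gt 0 (latticeFT (soStep d L) k).re with h | h
    · nlinarith [mul_le_mul_of_nonneg_right hμ1 h]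
    · nlinarith
  have hAe : ∀ x, soA d L μ (-x) = soA d L μ x := fun x => by
    simp only [soA, soStep_neg]
    unfold delta0
    simp only [neg_eq_zero]
  have hintA : IntegrableOn (fun k => (latticeFT (soA d L μ) k)⁻¹) (cube d) :=
    integrableOn_inv_latticeFT hd3 (summable_abs_soA μ) hAe (half_pos hK') hlowA
  -- Proposition 3.2
  obtain ⟨hfint, hf1, hderiv⟩ := h32' L hL₂ z β₀ β₁ Pz hβ₀ hβ₁ hβ2 ⟨hz1, hsymm, hbd, hF0⟩
  choose w hwint hwM hwid using hderiv
  -- (3.4): `f_z(x) = 𝒢_z(x) - λ_z S_{μ_z}(x) = Re (2π)^{-d} I(x)`, `I(x) = ∫ e^{ik·x} f̂_z`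
  set I : Site d → ℂ := fun x => ∫ k in cube d, Complex.exp (Complex.I * (kdot k x : ℂ)) * lsfHatC d L z Pz k
    with hIdef
  have hident : ∀ x : Site d, fourierInverseG F x - lam * soGreen d L μ x = (I x / ((2 * Real.pi : ℂ)) ^ d).re :=
    fun x => sub_eq_re_integral_lsfHatC hd3 hL1 hFabs hμ0 hμ1 hintF hintA x
  have h2π : ∀ w : ℂ, (w / ((2 * Real.pi : ℂ)) ^ d).re = A * w.re := by
    intro w
    have : ((2 * Real.pi : ℂ)) ^ d = (((2 * Real.pi) ^ d : ℝ) : ℂ) := by push_cast; ring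
    rw [this, Complex.div_ofReal_re, hAdef, div_eq_inv_mul]
  have hbound : ∀ x : Site d, |fourierInverseG F x - lam * soGreen d L μ x| ≤ A * ‖I x‖ := fun x => by
    rw [hident x, h2π, abs_mul, abs_of_pos hA0]
    exact mul_le_mul_of_nonneg_left (Complex.abs_re_le_norm _) hA0.le
  have he1 : ∀ (x : Site d) (k : Fin d → ℝ), ‖Complex.exp (Complex.I * (kdot k x : ℂ))‖ = 1 := fun x k => by
    rw [mul_comm, Complex.norm_exp_ofReal_mul_I]
  have hInorm : ∀ (g : (Fin d → ℝ) → ℂ) (x : Site d),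
      ‖∫ k in cube d, Complex.exp (Complex.I * (kdot k x : ℂ)) * g k‖ ≤ ∫ k in cube d, ‖g k‖ := by
    intro g x
    refine (norm_integral_le_integral_norm _).trans (le_of_eq ?_)
    refine setIntegral_congr_fun (measurableSet_cube d) fun k _ => ?_
    rw [norm_mul, he1, one_mul]
  -- the key estimate off the origin: `|x|ⁿ ‖I(x)‖ ≤ d^{n/2} ‖∫ e^{ik·x} w_j‖` for the maximising `j`
  have key : ∀ x : Site d, x ≠ 0 → ∃ j : Fin d, 1 ≤ euclidNorm x ∧
      euclidNorm x ^ lsND d ρ * ‖I x‖ ≤ Real.sqrt d ^ lsND d ρ *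
        ‖∫ k in cube d, Complex.exp (Complex.I * (kdot k x : ℂ)) * w j k‖ := by
    intro x hx
    obtain ⟨i₀, hi₀⟩ : ∃ i, x i ≠ 0 := by
      by_contra h
      push Not at h
      exact hx (funext h)
    obtain ⟨j, -, hj⟩ := Finset.exists_max_image Finset.univ (fun i => |x i|) ⟨i₀, Finset.mem_univ _⟩
    have hxj : x j ≠ 0 := by
      intro h0
      have := hj i₀ (Finset.mem_univ i₀)
      rw [h0, abs_zero] at this
      exact hi₀ (abs_nonpos_iff.1 this)
    set m : ℝ := |(x j : ℝ)| with hm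
    have hm1 : 1 ≤ m := by
      rw [hm, ← Int.cast_abs]
      exact_mod_cast Int.one_le_abs hxj
    have hm0 : 0 < m := by linarith
    have hji : ∀ i, |(x i : ℝ)| ≤ m := fun i => by
      rw [hm, ← Int.cast_abs, ← Int.cast_abs]
      exact_mod_cast hj i (Finset.mem_univ i)
    have hE : euclidNorm x ≤ Real.sqrt d * m := euclidNorm_le_sqrt_mul hm0.le hji
    have hE1 : 1 ≤ euclidNorm x := hm1.trans (abs_apply_le_euclidNorm x j)
    have hE0 : 0 < euclidNorm x := by linarith
    -- `|x_j|ⁿ ‖I x‖ = ‖∫ e^{ik·x} w_j‖`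
    have hstep : m ^ lsND d ρ * ‖I x‖ = ‖∫ k in cube d, Complex.exp (Complex.I * (kdot k x : ℂ)) * w j k‖ := by
      rw [hwid j x, norm_mul, norm_pow, norm_neg, norm_mul, Complex.norm_I, one_mul,
        Complex.norm_intCast, hm]
    refine ⟨j, hE1, ?_⟩
    calc euclidNorm x ^ lsND d ρ * ‖I x‖ ≤ (Real.sqrt d * m) ^ lsND d ρ * ‖I x‖ :=
          mul_le_mul_of_nonneg_right (pow_le_pow_left₀ hE0.le hE _) (norm_nonneg _)
      _ = Real.sqrt d ^ lsND d ρ * (m ^ lsND d ρ * ‖I x‖) := by rw [mul_pow]; ring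
      _ = _ := by rw [hstep]
  set Merr : ℝ := max β₀ β₁ * ((L : ℝ) ^ (-c) + max β₀ β₁) + β₁ with hMerr
  have herr_nn : 0 ≤ Merr :=
    add_nonneg (mul_nonneg hβnn (add_nonneg (Real.rpow_nonneg (Nat.cast_nonneg L) _) hβnn)) hβ₁
  refine ⟨?_, ?_, ?_, ?_⟩
  · -- absolute convergence of (2.1): torus side, from the torus-side infrared bound
    have hFcont : Continuous (latticeFourier F) := continuous_latticeFourier hFabs
    have hF0re' : (latticeFourier F 0).re = ∑' x, F x := by rw [latticeFourier_zero, Complex.ofReal_re]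
    refine integrable_inv_of_infrared hd3 hFcont hK fun t => ?_
    have h := hIR L hL₁ z β₀ β₁ Pz hβ₀ hβ₁ hβ1 hz1 hsymm hbd t
    have h0 : 0 ≤ (latticeFourier F 0).re := by rw [hF0re']; exact hF0
    have hminL : min (∑ i, ‖t i‖ ^ 2) 1 ≤ min ((L : ℝ) ^ 2 * ∑ i, ‖t i‖ ^ 2) 1 :=
      min_le_min_right _ (le_mul_of_one_le_left (Finset.sum_nonneg fun i _ => sq_nonneg _)
        (one_le_pow₀ hL1r))
    calc K * min (∑ i, ‖t i‖ ^ 2) 1 ≤ K * min ((L : ℝ) ^ 2 * ∑ i, ‖t i‖ ^ 2) 1 :=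
          mul_le_mul_of_nonneg_left hminL hK.le
      _ ≤ (latticeFourier F t).re := by linarith
  · -- `x = 0`: `|f_z(0)| ≤ (2π)^{-d}∫|f̂_z| ≤ (2π)^{-d}C₂β`
    calc |fourierInverseG F 0 - lam * soGreen d L μ 0| ≤ A * ‖I 0‖ := hbound 0
      _ ≤ A * (C₂ * max β₀ β₁) := mul_le_mul_of_nonneg_left ((hInorm _ 0).trans hf1) hA0.le
      _ = A * C₂ * max β₀ β₁ := by ring
      _ ≤ max (A * C₂) (A * Real.sqrt d ^ lsND d ρ * C₂) * max β₀ β₁ :=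
          mul_le_mul_of_nonneg_right (le_max_left _ _) hβnn
  · -- `x ≠ 0`: Lemma 3.1 in the maximising direction with the top-order bound (3.9)
    intro x hx
    obtain ⟨j, hE1, hkey⟩ := key x hx
    have hE0 : 0 < euclidNorm x := by linarith
    have hIx : ‖I x‖ ≤ Real.sqrt d ^ lsND d ρ * (C₂ * Merr) / euclidNorm x ^ lsND d ρ := by
      rw [le_div_iff₀ (pow_pos hE0 _), mul_comm]
      exact hkey.trans (mul_le_mul_of_nonneg_left ((hInorm _ x).trans (hwM j)) (by positivity))
    calc |fourierInverseG F x - lam * soGreen d L μ x| ≤ A * ‖I x‖ := hbound x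
      _ ≤ A * (Real.sqrt d ^ lsND d ρ * (C₂ * Merr) / euclidNorm x ^ lsND d ρ) :=
          mul_le_mul_of_nonneg_left hIx hA0.le
      _ = A * Real.sqrt d ^ lsND d ρ * C₂ * Merr / euclidNorm x ^ lsND d ρ := by ring
      _ ≤ max (A * C₂) (A * Real.sqrt d ^ lsND d ρ * C₂) * Merr / euclidNorm x ^ lsND d ρ := by
          gcongr
          exact le_max_right _ _
  · -- `f_z(x) = o(|x|^{-n_d})`: Riemann–Lebesgue for the `w_j`
    have hRL : Tendsto (fun x : Site d => A * Real.sqrt d ^ lsND d ρ *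
        ∑ j, ‖∫ k in cube d, Complex.exp (Complex.I * (kdot k x : ℂ)) * w j k‖) cofinite (𝓝 0) := by
      have h := tendsto_finsetSum Finset.univ fun j (_ : j ∈ Finset.univ) =>
        (tendsto_setIntegral_cube_cexp_mul_cofinite (w j)).norm
      simp only [norm_zero, Finset.sum_const_zero] at h
      simpa using h.const_mul (A * Real.sqrt d ^ lsND d ρ)
    refine squeeze_zero_norm' ?_ hRL
    have hfin : Set.Finite {x : Site d | x = 0} := by
      simp only [Set.setOf_eq_eq_singleton, Set.finite_singleton]
    filter_upwards [hfin.compl_mem_cofinite] with x hx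
    have hx0 : x ≠ 0 := fun h => hx (by simpa using h)
    obtain ⟨j, -, hkey⟩ := key x hx0
    rw [norm_mul, Real.norm_eq_abs, Real.norm_eq_abs, abs_of_nonneg (pow_nonneg (euclidNorm_nonneg x) _)]
    calc |fourierInverseG F x - lam * soGreen d L μ x| * euclidNorm x ^ lsND d ρ
        ≤ A * ‖I x‖ * euclidNorm x ^ lsND d ρ :=
          mul_le_mul_of_nonneg_right (hbound x) (pow_nonneg (euclidNorm_nonneg x) _)
      _ = A * (euclidNorm x ^ lsND d ρ * ‖I x‖) := by ring
      _ ≤ A * (Real.sqrt d ^ lsND d ρ * ‖∫ k in cube d, Complex.exp (Complex.I * (kdot k x : ℂ)) * w j k‖) :=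
          mul_le_mul_of_nonneg_left hkey hA0.le
      _ ≤ A * (Real.sqrt d ^ lsND d ρ *
            ∑ i, ‖∫ k in cube d, Complex.exp (Complex.I * (kdot k x : ℂ)) * w i k‖) := by
          gcongr
          exact Finset.single_le_sum
            (fun i _ => norm_nonneg (∫ k in cube d, Complex.exp (Complex.I * (kdot k x : ℂ)) * w i k))
            (Finset.mem_univ j)
      _ = A * Real.sqrt d ^ lsND d ρ *
            ∑ i, ‖∫ k in cube d, Complex.exp (Complex.I * (kdot k x : ℂ)) * w i k‖ := by ring

end Literature.Barriers.CriticalPhenomena.SpreadOutIsing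

end
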